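import Summits.BirchSwinnertonDyer.BirchSwinnertonDyer.Theorems.ClassRecordThreeEulerHalvesAtThreeCartanCoverHeckeDatumCertificate
import HarnessLib

/-!
# The inert-Hecke certificate for (OBS), part D — THE ELLIPTIC-NULL ENGINE (theorems only)

Support file for crux `CartanOnePlaceDegreeLawAtThree` (NUM; item stmt-BirchSwinnertonDyer-24801; registered line `Lines/lattice`, Galois leaf (OBS)
`CartanCover.Charext.NoModThreePeriodCharacterExtension`). LEAD bsd-stepL tam3-p1 g28, continuing cruxidea-24801-1's parts A–C
(`…CartanCoverHeckeDatum{,Cover,Certificate}`); consumed by part E `…CartanCoverCuspidalEigenPackage` (the certificate's output (EIG′) of bsd-idea-10's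
`…CartanCarayolLift`, p742701). THEOREMS ONLY (no definition, no named fact).
§1 ELEMENTARY LEMMAS: `det g = 1`, `g³ = 1 ≠ g` ⇒ `g² + g + 1 = 0` (`2 × 2`, Cayley–Hamilton); the kernel of a non-zero singular `2 × 2` matrix is a line;
`3 • x = 0 ∧ n • x = 0 ⇒ x = 0` (`n ∈ {1, 2, 4}`); `χ(uⁿ) = n • χ(u)`.
§2 THE ENGINE `apply_eq_zero_of_cube_eq_one` ∕ `apply_eq_zero_of_pow_twelve`: under the (T13′) hypotheses at ONE prime `ℓ ≡ 2 (mod 3)` with `3 ∤ a` and a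
residue map of the cover order `O₀'` at `ℓ` (kernel `ℓ O₀'`, `det ∘ red = nrd`: the THEOREM `exists_coverResidueMap_of_not_dvd`, p742978), the cochain `χ̄` kills
every `y ∈ ι(O₀'¹)` with `y³ = 1` (`y² + y + 1 = 0` as `det y = 1`, so `ȳ = red y` has `ȳ³ = 1 ≠ ȳ` for `ℓ ≠ 3`; the representatives `α_i ∈ X.O ⊆ O₀'` of reduced norm
`ℓ` reduce to NON-ZERO SINGULAR matrices whose kernel lines `e_i` realise the `ℙ¹(𝔽_ℓ)`-identification: `α_i y = w α_{σ i}` gives `ᾱ_i ȳ e_{σ i} = 0`, i.e.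
`ȳ e_{σ i} ∈ 𝔽_ℓ e_i`; (T6) makes `σ_y` fixed-point-free and (T13′) concludes), hence every `u` with `u¹² = 1` (`4 • χ̄ u = χ̄(u⁴) = 0 = 3 • χ̄ u`).
HONEST: sorry-free lemmas; nothing about any curve's `L`-value; OBS ∕ 24801 ∕ 23422 ∕ 19109 open; BSD is proved for no curve.
-/

set_option linter.dupNamespace false
set_option autoImplicit false

noncomputable section

open scoped Classical MatrixGroups

namespace Summit.BirchSwinnertonDyer.BirchSwinnertonDyer.Theorems.CartanCover.Charext.InertHecke

open Literature.NumberTheory.Automorphic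

/-! ## §1 Elementary lemmas -/

/-- A `2 × 2` matrix over a field with `det g = 1`, `g³ = 1`, `g ≠ 1` satisfies `g² + g + 1 = 0` (Cayley–Hamilton `g² = t g − 1` gives
`g³ = (t² − 1) g − t`; if `t ≠ −1` the matrix is forced to be `1`). [folklore] -/
theorem sq_add_self_add_one_eq_zero_of_cube_eq_one {K : Type*} [Field K] (g : Matrix (Fin 2) (Fin 2) K) (hdet : g.det = 1)
    (h3 : g ^ 3 = 1) (h1 : g ≠ 1) : g ^ 2 + g + 1 = 0 := by
  have hCH : g * g = g.trace • g - (1 : Matrix (Fin 2) (Fin 2) K) := by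
    have h : g * g = g.trace • g - g.det • (1 : Matrix (Fin 2) (Fin 2) K) := by
      ext i j
      fin_cases i <;> fin_cases j <;>
        simp [Matrix.mul_apply, Fin.sum_univ_two, Matrix.trace, Matrix.det_fin_two] <;> ring
    rw [h, hdet, one_smul]
  set t := g.trace with ht
  have hcube : g ^ 3 = (t ^ 2 - 1) • g - t • (1 : Matrix (Fin 2) (Fin 2) K) := by
    rw [pow_succ, pow_two, hCH, sub_mul, smul_mul_assoc, hCH, one_mul, smul_sub, smul_smul]
    module
  by_cases htm : t = -1
  · rw [pow_two, hCH, htm]; module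
  · exfalso
    apply h1
    have key : (t ^ 2 - 1) • g = (t + 1) • (1 : Matrix (Fin 2) (Fin 2) K) := by
      have e := hcube.symm.trans h3
      rw [sub_eq_iff_eq_add] at e
      rw [e]; module
    have ht1 : t + 1 ≠ 0 := fun h => htm (by linear_combination h)
    -- entries of `key`
    have e00 := congrArg (fun m : Matrix (Fin 2) (Fin 2) K => m 0 0) key
    have e01 := congrArg (fun m : Matrix (Fin 2) (Fin 2) K => m 0 1) key
    have e10 := congrArg (fun m : Matrix (Fin 2) (Fin 2) K => m 1 0) key
    have e11 := congrArg (fun m : Matrix (Fin 2) (Fin 2) K => m 1 1) key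
    simp only [Matrix.smul_apply, Matrix.one_apply_eq, Matrix.one_apply_ne, ne_eq, zero_ne_one, not_false_eq_true,
      one_ne_zero, smul_eq_mul, mul_one, mul_zero] at e00 e01 e10 e11
    have ht2 : t ^ 2 - 1 ≠ 0 := by
      intro h; rw [h, zero_mul] at e00; exact ht1 e00.symm
    have hb : g 0 1 = 0 := (mul_eq_zero.mp e01).resolve_left ht2
    have hc : g 1 0 = 0 := (mul_eq_zero.mp e10).resolve_left ht2
    have had : g 0 0 = g 1 1 := by
      have := e00.trans e11.symm
      exact mul_left_cancel₀ ht2 this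
    have htr : t = g 0 0 + g 1 1 := by rw [ht, Matrix.trace_fin_two]
    have hdet' : g 0 0 * g 1 1 - g 0 1 * g 1 0 = 1 := by rw [← Matrix.det_fin_two]; exact hdet
    rw [hb, hc, mul_zero, sub_zero, ← had] at hdet'
    -- a := g 0 0: a² = 1, t = 2a, (t² - 1) a = t + 1 ⇒ 3a = 2a + 1 ⇒ a = 1
    have ha : g 0 0 = 1 := by
      have h4 : t ^ 2 - 1 = 3 := by rw [htr, ← had]; linear_combination (4 : K) * hdet'
      rw [h4, htr, ← had] at e00
      linear_combination e00
    ext i j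
    fin_cases i <;> fin_cases j
    · simpa using ha
    · simpa using hb
    · simpa using hc
    · simpa [← had] using ha

/-- The kernel of a non-zero singular `2 × 2` matrix over a field is a line: two kernel vectors, the first non-zero, are proportional. [folklore] -/
theorem exists_smul_eq_of_mulVec_eq_zero {K : Type*} [Field K] (A : Matrix (Fin 2) (Fin 2) K) (hA : A ≠ 0)
    {v w : Fin 2 → K} (hv : v ≠ 0) (hAv : A.mulVec v = 0) (hAw : A.mulVec w = 0) : ∃ c : K, w = c • v := by
  -- a non-zero row `r` of `A`
  obtain ⟨i, hi⟩ : ∃ i, A i ≠ 0 := by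
    by_contra h; push Not at h; exact hA (Matrix.ext fun i j => by rw [h i]; rfl)
  have hrv : A i 0 * v 0 + A i 1 * v 1 = 0 := by
    have := congrFun hAv i
    simpa [Matrix.mulVec, dotProduct, Fin.sum_univ_two] using this
  have hrw : A i 0 * w 0 + A i 1 * w 1 = 0 := by
    have := congrFun hAw i
    simpa [Matrix.mulVec, dotProduct, Fin.sum_univ_two] using this
  have hv' : v 0 ≠ 0 ∨ v 1 ≠ 0 := by
    by_contra h; push Not at h; exact hv (funext fun k => by fin_cases k <;> simp [h.1, h.2])
  by_cases hr0 : A i 0 = 0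
  · -- then `A i 1 ≠ 0`, so `v 1 = 0 = w 1`, `v 0 ≠ 0`
    have hr1 : A i 1 ≠ 0 := by
      intro h; apply hi; funext k; fin_cases k <;> simp [hr0, h]
    rw [hr0, zero_mul, zero_add] at hrv hrw
    have hv1 : v 1 = 0 := (mul_eq_zero.mp hrv).resolve_left hr1
    have hw1 : w 1 = 0 := (mul_eq_zero.mp hrw).resolve_left hr1
    have hv0 : v 0 ≠ 0 := hv'.resolve_right (not_not.mpr hv1)
    refine ⟨w 0 / v 0, funext fun k => ?_⟩
    fin_cases k
    · simp [div_mul_cancel₀ _ hv0]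
    · simp [hv1, hw1]
  · -- `A i 0 ≠ 0`: `x 0 = -(A i 1 / A i 0) x 1` on the kernel, so `v 1 ≠ 0`
    have hv1 : v 1 ≠ 0 := by
      intro h
      rw [h, mul_zero, add_zero] at hrv
      rcases mul_eq_zero.mp hrv with h' | h'
      · exact hr0 h'
      · exact (hv'.resolve_right (not_not.mpr h)) h'
    refine ⟨w 1 / v 1, funext fun k => ?_⟩
    fin_cases k
    · have ev : v 0 = -(A i 1 / A i 0) * v 1 := by field_simp; linear_combination hrv
      have ew : w 0 = -(A i 1 / A i 0) * w 1 := by field_simp; linear_combination hrw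
      simp only [Fin.zero_eta, Pi.smul_apply, smul_eq_mul]
      rw [ev, ew]; field_simp
    · simp [div_mul_cancel₀ _ hv1]

/-- `3 • x = 0` and `n • x = 0` with `n ∈ {1, 2, 4}` force `x = 0`. [folklore] -/
theorem eq_zero_of_three_nsmul_of_nsmul {A : Type*} [AddCommGroup A] {x : A} (h3 : 3 • x = 0) {n : ℕ}
    (hn : n = 1 ∨ n = 2 ∨ n = 4) (hnx : n • x = 0) : x = 0 := by
  rcases hn with rfl | rfl | rfl
  · simpa using hnx
  · have e : x = 3 • x - 2 • x := by rw [show (3 : ℕ) = 2 + 1 from rfl, succ_nsmul]; abel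
    rw [e, h3, hnx, sub_zero]
  · have e : x = 4 • x - 3 • x := by rw [show (4 : ℕ) = 3 + 1 from rfl, succ_nsmul]; abel
    rw [e, h3, hnx, sub_zero]

/-- `χ (u ^ n) = n • χ u` for an additive cochain. [folklore] -/
theorem apply_pow_eq_nsmul {G A : Type*} [Monoid G] [AddCommGroup A] (χ : G → A) (hχ : ∀ a b, χ (a * b) = χ a + χ b)
    (u : G) (n : ℕ) : χ (u ^ n) = n • χ u := by
  have h1 : χ 1 = 0 := by
    have h := hχ 1 1; rw [one_mul] at h
    simpa using h
  induction n with
  | zero => rw [pow_zero, zero_nsmul, h1]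
  | succ n ih => rw [pow_succ, hχ, ih, succ_nsmul]

/-! ## §2 The elliptic-null engine -/

section Engine

variable {D M : ℕ} {C : Finset ℕ} (X : CartanLevelCurveData D M C)

/-- **Cube roots of unity in `ι(O₀'¹)` are killed** — the heart of the inert-Hecke certificate: under the hypotheses of (T13′) at a prime
`ℓ ≡ 2 (mod 3)` with `3 ∤ a`, plus a residue map (RED_ℓ) of `O₀'` at `ℓ`, every `y ∈ ι(O₀'¹)` with `y³ = 1` has `χ̄(y) = 0`. For `y ≠ 1`:
`y² + y + 1 = 0` (determinant `1`), so `ȳ = red(y)` has `ȳ³ = 1 ≠ ȳ` (`ℓ ≠ 3`); the representatives `α_i` (reduced norm `ℓ`, in `X.O ⊆ O₀'`) reduce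
to NON-ZERO SINGULAR matrices `ᾱ_i` (kernel `ℓ O₀'` and `det ∘ red = nrd`), whose kernel lines `e_i` realise the `ℙ¹(𝔽_ℓ)`-identification:
`α_i y = w α_{σ i}` (`w ∈ ι(O₀'¹)`) gives `ᾱ_i ȳ e_{σ i} = 0`, i.e. `ȳ e_{σ i} ∈ 𝔽_ℓ e_i`; (T6) makes `σ = σ_y` fixed-point-free and (T13′) concludes.
[cite: ShimuraIATAF1971, Prop. 3.36 and §3.3] [cite: VignerasLNM800, Ch. II §2 Thm. 2.3] -/
theorem apply_eq_zero_of_cube_eq_one {q : ℕ} [Fact q.Prime] (hq : q ∈ C) (hq3 : q ≠ 3) (R : CartanCover.CoverReduction X q)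
    {ℓ : ℕ} [Fact ℓ.Prime] (hℓ : ℓ % 3 = 2) [Fintype (Quotient (X.heckeSetoid ℓ))]
    (red : CartanCover.coverSubring X q →+* Matrix (Fin 2) (Fin 2) (ZMod ℓ))
    (hred0 : ∀ x : CartanCover.coverSubring X q, red x = 0 ↔ ∃ y ∈ CartanCover.coverOrder X q, (x : X.B) = (ℓ : ℤ) • y)
    (hdet : ∀ x : CartanCover.coverSubring X q, ∃ n : ℤ, reducedNorm ℚ X.B (x : X.B) = n ∧ (red x).det = (n : ZMod ℓ))
    (g : Quotient (X.heckeSetoid ℓ) → X.Gamma)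
    (disjU : ∀ (i j : Quotient (X.heckeSetoid ℓ)) (u : GL (Fin 2) ℝ), u ∈ CartanCover.coverUnits X q →
      ((gammaHeckeDatum X ℓ).changeReps g).α i = u * ((gammaHeckeDatum X ℓ).changeReps g).α j → i = j)
    (stabU : ∀ (u : CartanCover.coverUnits X q) (i : Quotient (X.heckeSetoid ℓ)), ∃ j,
      ((gammaHeckeDatum X ℓ).changeReps g).α i * u * (((gammaHeckeDatum X ℓ).changeReps g).α j)⁻¹ ∈ CartanCover.coverUnits X q)
    (memN : ∀ (β : CartanCover.principalLevel X q) (i : Quotient (X.heckeSetoid ℓ)),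
      ((gammaHeckeDatum X ℓ).changeReps g).α i * β *
        (((gammaHeckeDatum X ℓ).changeReps g).α (((gammaHeckeDatum X ℓ).changeReps g).σ ⟨β, CartanCover.principalLevel_le_Gamma X q hq β.2⟩ i))⁻¹ ∈
        CartanCover.principalLevel X q)
    {A : Type*} [AddCommGroup A] (χ : CartanCover.coverUnits X q → A) (hχ : ∀ a b, χ (a * b) = χ a + χ b) (h3 : ∀ γ, 3 • χ γ = 0)
    (ψ : CartanCover.principalLevel X q → A)
    (hagree : ∀ (β : GL (Fin 2) ℝ) (hβ : β ∈ CartanCover.principalLevel X q),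
      χ ⟨β, CartanCover.principalLevel_le_coverUnits X q hβ⟩ = ψ ⟨β, hβ⟩)
    (a : ℤ) (ha : ¬ (3 : ℤ) ∣ a) (heig : ∀ β : CartanCover.principalLevel X q,
      (((gammaHeckeDatum X ℓ).changeReps g).restrict (CartanCover.principalLevel X q) (CartanCover.principalLevel_le_Gamma X q hq) memN).op ψ β
        = a • ψ β)
    (y : CartanCover.coverUnits X q) (hy : y ^ 3 = 1) : χ y = 0 := by
  classical
  have hχ1 : χ 1 = 0 := by
    have h := hχ 1 1; rw [one_mul] at h
    simpa using h
  by_cases hy1 : y = 1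
  · rw [hy1]; exact hχ1
  -- the Hecke datum of the cover and its representatives
  set H := HeckeDatum.ofStable (Γ := CartanCover.coverUnits X q) ((gammaHeckeDatum X ℓ).changeReps g).α disjU stabU with hH
  have hHα : ∀ i, H.α i = ((g i : GL (Fin 2) ℝ)) * (((i.out : X.heckeSet ℓ)) : GL (Fin 2) ℝ) := by
    intro i
    rw [hH, HeckeDatum.ofStable_α]
    show ((g i : GL (Fin 2) ℝ)) * (gammaHeckeDatum X ℓ).α i = _
    rw [gammaHeckeDatum_α]
  -- ℓ ≠ 3
  have hℓ3 : ℓ ≠ 3 := by rintro rfl; norm_num at hℓ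
  have hℓp : ℓ.Prime := Fact.out
  -- lifts of the representatives to `O₀'`, of reduced norm `ℓ`
  have hlift : ∀ i, ∃ x : CartanCover.coverSubring X q,
      X.ι (x : X.B) = ((H.α i : GL (Fin 2) ℝ) : Matrix (Fin 2) (Fin 2) ℝ) ∧ ((H.α i : GL (Fin 2) ℝ) : Matrix (Fin 2) (Fin 2) ℝ).det = ℓ := by
    intro i
    obtain ⟨⟨xg, hxg, hxgι⟩, -, hgdet⟩ := (g i).2
    obtain ⟨⟨xo, hxo, hxoι⟩, hodet⟩ := (i.out : X.heckeSet ℓ).2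
    refine ⟨⟨xg * xo, (CartanCover.coverSubring X q).mul_mem (CartanCover.le_coverOrder X q hxg) (CartanCover.le_coverOrder X q hxo)⟩, ?_, ?_⟩
    · simp only [hHα, Units.val_mul, map_mul, hxgι, hxoι]
    · rw [hHα, Units.val_mul, Matrix.det_mul, ← Matrix.GeneralLinearGroup.val_det_apply, hgdet, Units.val_one, one_mul, hodet]
  choose αt hαtι hαtdet using hlift
  -- reduced norms through the residue map: `det (red x) = nrd x (mod ℓ)` and `det (ι x) = nrd x` in `ℝ`
  have hnrd : ∀ x : CartanCover.coverSubring X q, ∃ n : ℤ, (X.ι (x : X.B)).det = (n : ℝ) ∧ (red x).det = (n : ZMod ℓ) := by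
    intro x
    obtain ⟨n, hn, hd⟩ := hdet x
    refine ⟨n, ?_, hd⟩
    rw [AlgHom.det_eq_reducedNorm X.ι (x : X.B), hn]
    simp
  -- the reduced representatives are singular …
  have hαdet : ∀ i, (red (αt i)).det = 0 := by
    intro i
    obtain ⟨n, hn, hd⟩ := hnrd (αt i)
    rw [hαtι, hαtdet] at hn
    have hnℓ : n = ℓ := by exact_mod_cast hn.symm
    rw [hd, hnℓ]
    simp
  -- … and non-zero
  have hα0 : ∀ i, red (αt i) ≠ 0 := by
    intro i h0
    obtain ⟨z, hz, hzeq⟩ := (hred0 (αt i)).mp h0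
    obtain ⟨n, hn, -⟩ := hnrd ⟨z, hz⟩
    have e : ((H.α i : GL (Fin 2) ℝ) : Matrix (Fin 2) (Fin 2) ℝ).det = (ℓ : ℝ) ^ 2 * n := by
      change (X.ι z).det = (n : ℝ) at hn
      rw [← hαtι, hzeq, map_zsmul, ← Int.cast_smul_eq_zsmul ℝ, Matrix.det_smul, Fintype.card_fin, Int.cast_natCast, hn]
    rw [hαtdet] at e
    -- `ℓ = ℓ² n` in `ℝ` with `n ∈ ℤ` is impossible for a prime `ℓ`
    have e' : (ℓ : ℝ) * (1 - ℓ * n) = 0 := by linear_combination e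
    have hℓ0 : (ℓ : ℝ) ≠ 0 := by exact_mod_cast hℓp.ne_zero
    have e'' : (1 : ℝ) - ℓ * n = 0 := (mul_eq_zero.mp e').resolve_left hℓ0
    have e3 : (ℓ : ℤ) * n = 1 := by exact_mod_cast (by linear_combination -e'' : (ℓ : ℝ) * n = 1)
    have := Int.eq_one_of_mul_eq_one_right (by exact_mod_cast hℓp.pos.le) e3
    have h1 : ℓ = 1 := by exact_mod_cast this
    exact hℓp.one_lt.ne' h1
  -- kernel lines `e i` of the reduced representatives
  have hker : ∀ i, ∃ v : Fin 2 → ZMod ℓ, v ≠ 0 ∧ (red (αt i)).mulVec v = 0 := fun i =>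
    Matrix.exists_mulVec_eq_zero_iff.mpr (hαdet i)
  choose e he hαe using hker
  -- the reduction of `y`
  set ybar : Matrix (Fin 2) (Fin 2) (ZMod ℓ) := red (CartanCover.unitLift y) with hybar
  have hydet : ((y : GL (Fin 2) ℝ) : Matrix (Fin 2) (Fin 2) ℝ).det = 1 := by
    rw [← Matrix.GeneralLinearGroup.val_det_apply, y.2.2.2, Units.val_one]
  have hY3 : ((y : GL (Fin 2) ℝ) : Matrix (Fin 2) (Fin 2) ℝ) ^ 3 = 1 := by
    have := congrArg (fun u : CartanCover.coverUnits X q => ((u : GL (Fin 2) ℝ) : Matrix (Fin 2) (Fin 2) ℝ)) hy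
    simpa [Units.val_pow_eq_pow_val] using this
  have hY1 : ((y : GL (Fin 2) ℝ) : Matrix (Fin 2) (Fin 2) ℝ) ≠ 1 := by
    intro h; apply hy1
    apply Subtype.ext; apply Units.ext; exact h
  have hYmin := sq_add_self_add_one_eq_zero_of_cube_eq_one _ hydet hY3 hY1
  have hymin' : (CartanCover.unitLift y) ^ 2 + CartanCover.unitLift y + 1 = 0 := by
    apply Subtype.ext
    apply X.ι_injective
    simp only [Subring.coe_add, Subring.coe_pow, Subring.coe_one, Subring.coe_zero, map_add, map_pow, map_one, map_zero,
      CartanCover.ι_unitLift]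
    exact hYmin
  have hymin : ybar ^ 2 + ybar + 1 = 0 := by
    have := congrArg red hymin'
    simpa [hybar] using this
  have hybar3 : ybar ^ 3 = 1 := cube_eq_one_of_sq_add_self_add_one_eq_zero ybar hymin
  have hybar1 : ybar ≠ 1 := ne_one_of_sq_add_self_add_one_eq_zero hℓ3 ybar hymin
  -- equivariance: `α_i y = w α_{σ i}` read through `red` on kernel lines
  have hequi0 : ∀ i, ∃ c : ZMod ℓ, ybar.mulVec (e (H.σ y i)) = c • e i := by
    intro i
    set w : CartanCover.coverUnits X q := ⟨_, H.mem y i⟩ with hw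
    -- in `B`: `αt i * lift y = lift w * αt (σ i)`
    have hB : αt i * CartanCover.unitLift y = CartanCover.unitLift w * αt (H.σ y i) := by
      apply Subtype.ext
      apply X.ι_injective
      simp only [Subring.coe_mul, map_mul, hαtι, CartanCover.ι_unitLift, hw]
      rw [← Units.val_mul, ← Units.val_mul]
      congr 1
      rw [mul_assoc, inv_mul_cancel, mul_one]  -- hmm shape
    have hred := congrArg red hB
    rw [map_mul, map_mul] at hred
    refine exists_smul_eq_of_mulVec_eq_zero (red (αt i)) (hα0 i) (he i) (hαe i) ?_
    rw [Matrix.mulVec_mulVec, ← hybar] at *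
    have : (red (αt i) * ybar).mulVec (e (H.σ y i)) = 0 := by
      rw [show red (αt i) * ybar = red (CartanCover.unitLift w) * red (αt (H.σ y i)) from hred, ← Matrix.mulVec_mulVec, hαe,
        Matrix.mulVec_zero]
    simpa [Matrix.mulVec_mulVec] using this
  have hequi : ∀ i, ∃ c : ZMod ℓ, ybar.mulVec (e i) = c • e ((H.σ y).symm i) := by
    intro i
    obtain ⟨c, hc⟩ := hequi0 ((H.σ y).symm i)
    rw [Equiv.apply_symm_apply] at hc
    exact ⟨c, hc⟩
  have hτ := fixedPointFree_of_projective_equivariance hℓ ybar hybar3 hybar1 (fun i => (H.σ y).symm i) e he hequi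
  have hfix : ∀ i, H.σ y i ≠ i := by
    intro i hi
    apply hτ i
    rw [Equiv.symm_apply_eq]; exact hi.symm
  -- (T13′) with `x = y`, `c = 1`
  have h := cover_apply_eq_zero_of_cube_central_on X hq hq3 R ℓ g disjU stabU memN χ hχ h3 ψ hagree a ha heig y 1 hy
    (fun g' => by simp) hfix
  exact h

/-- **THE ELLIPTIC-NULL ENGINE**: under the same hypotheses, `χ̄(u) = 0` for every `u ∈ ι(O₀'¹)` with `u¹² = 1` — so for every element of finite
order (orders `1, 2, 3, 4, 6`): `(u⁴)³ = 1` gives `4 • χ̄(u) = χ̄(u⁴) = 0`, and `3 • χ̄(u) = 0`. This is the hypothesis «kills every `u` with `u¹² = 1`» of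
(AUTOCONV). [cite: ShimuraIATAF1971, Prop. 3.36 and §3.3] -/
theorem apply_eq_zero_of_pow_twelve {q : ℕ} [Fact q.Prime] (hq : q ∈ C) (hq3 : q ≠ 3) (R : CartanCover.CoverReduction X q)
    {ℓ : ℕ} [Fact ℓ.Prime] (hℓ : ℓ % 3 = 2) [Fintype (Quotient (X.heckeSetoid ℓ))]
    (red : CartanCover.coverSubring X q →+* Matrix (Fin 2) (Fin 2) (ZMod ℓ))
    (hred0 : ∀ x : CartanCover.coverSubring X q, red x = 0 ↔ ∃ y ∈ CartanCover.coverOrder X q, (x : X.B) = (ℓ : ℤ) • y)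
    (hdet : ∀ x : CartanCover.coverSubring X q, ∃ n : ℤ, reducedNorm ℚ X.B (x : X.B) = n ∧ (red x).det = (n : ZMod ℓ))
    (g : Quotient (X.heckeSetoid ℓ) → X.Gamma)
    (disjU : ∀ (i j : Quotient (X.heckeSetoid ℓ)) (u : GL (Fin 2) ℝ), u ∈ CartanCover.coverUnits X q →
      ((gammaHeckeDatum X ℓ).changeReps g).α i = u * ((gammaHeckeDatum X ℓ).changeReps g).α j → i = j)
    (stabU : ∀ (u : CartanCover.coverUnits X q) (i : Quotient (X.heckeSetoid ℓ)), ∃ j,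
      ((gammaHeckeDatum X ℓ).changeReps g).α i * u * (((gammaHeckeDatum X ℓ).changeReps g).α j)⁻¹ ∈ CartanCover.coverUnits X q)
    (memN : ∀ (β : CartanCover.principalLevel X q) (i : Quotient (X.heckeSetoid ℓ)),
      ((gammaHeckeDatum X ℓ).changeReps g).α i * β *
        (((gammaHeckeDatum X ℓ).changeReps g).α (((gammaHeckeDatum X ℓ).changeReps g).σ ⟨β, CartanCover.principalLevel_le_Gamma X q hq β.2⟩ i))⁻¹ ∈
        CartanCover.principalLevel X q)
    {A : Type*} [AddCommGroup A] (χ : CartanCover.coverUnits X q → A) (hχ : ∀ a b, χ (a * b) = χ a + χ b) (h3 : ∀ γ, 3 • χ γ = 0)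
    (ψ : CartanCover.principalLevel X q → A)
    (hagree : ∀ (β : GL (Fin 2) ℝ) (hβ : β ∈ CartanCover.principalLevel X q),
      χ ⟨β, CartanCover.principalLevel_le_coverUnits X q hβ⟩ = ψ ⟨β, hβ⟩)
    (a : ℤ) (ha : ¬ (3 : ℤ) ∣ a) (heig : ∀ β : CartanCover.principalLevel X q,
      (((gammaHeckeDatum X ℓ).changeReps g).restrict (CartanCover.principalLevel X q) (CartanCover.principalLevel_le_Gamma X q hq) memN).op ψ β
        = a • ψ β) :
    ∀ u : CartanCover.coverUnits X q, u ^ 12 = 1 → χ u = 0 := by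
  intro u hu
  have h4 : χ (u ^ 4) = 0 :=
    apply_eq_zero_of_cube_eq_one X hq hq3 R hℓ red hred0 hdet g disjU stabU memN χ hχ h3 ψ hagree a ha heig (u ^ 4)
      (by rw [← pow_mul]; exact hu)
  rw [apply_pow_eq_nsmul χ hχ u 4] at h4
  exact eq_zero_of_three_nsmul_of_nsmul (h3 u) (Or.inr (Or.inr rfl)) h4


end Engine

end Summit.BirchSwinnertonDyer.BirchSwinnertonDyer.Theorems.CartanCover.Charext.InertHecke

end
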